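import Summits.AtomisticToContinuum.FouriersLaw.Theorems.PhononMeanFreePathIncoherentChannelShiftedDissipation
import Summits.AtomisticToContinuum.FouriersLaw.Theorems.PhononMeanFreePathIncoherentChannelLeftSensitivityAssembly
import Summits.AtomisticToContinuum.FouriersLaw.Theorems.PhononMeanFreePathIncoherentChannelSemigroupBudget

/-!
# `IncoherentChannel`, line `two-horizons-forecast-loss` — the left-sensitivity budget FROM ANY START TIME

Helper file for crux `PhononMeanFreePath.IncoherentChannel` (item stmt-AtomisticToContinuum-11811, route
`PhononMeanFreePath`, sub-problem `FouriersLaw`), registered stub `leftSensitivity_tail_budget`, in the vocabulary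
of `PhononMeanFreePathDefs`.

`P = pinnedChain ω₂ lam β γ` is the `(N+1)`-site pinned anharmonic chain with both Langevin baths at `T > 0`,
`μ₀ = P.gibbsMeasure (N+1) T`, `K_s = P.transitionKernel (N+1) T T s⁺`, `ν = gaussianReal 0 T`; for `x = (z, σ)`
the RESAMPLED microstate is `z̃ = (z.1, update z.2 0 σ)` (the near-bath momentum `p₀` replaced by a fresh
Gaussian); `v_s = fcast … N s = K_s p_N` is the mean forecast of the far bath momentum and
`S_N(s) = fnorm … N s = ‖v_s‖²_{L²(μ₀)}` its forecast norm. The LEFT SENSITIVITY is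
`D_N(s) = ∫ (v_s(z) − v_s(z̃))² d(μ₀ ⊗ ν)`.

The tree has the budget from time `0`, `∫_{0<s≤t} D_N(s) ds ≤ π² T/(8γ)` (`leftSensitivity_budget_holds`). This file
proves the same budget STARTED AT ANY TIME `t₁ ≥ 0`, slaved to the forecast norm at `t₁`:

  `∫_{0<s≤t} D_N(t₁ + s) ds ≤ (π²/(8γ)) · S_N(t₁)`     (`leftSensitivity_tail_budget`; `S_N(0) = T`).

Route. (1) `leftSensitivity_tail_budget_smooth`: for `F ∈ C_c`,
`∫_{0<s≤t} ∫⁻ ofReal(((K_{t₁+s}F)(z) − (K_{t₁+s}F)(z̃))²) d(μ₀ ⊗ ν) ds ≤ ofReal((π²/(8γ)) ∫ (K_{t₁}F)² dμ₀)` — the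
proof of `leftSensitivity_budget_smooth` (fibre Poincaré inequality `lintegral_resample_sq_le_bathWeight` at each
time, the forecast being `C²` for `t₁ + s > 0` by `contDiff_forecast`) with the dissipation inequality on the SHIFTED
window `dissipation_lintegral_le_shifted` in place of the unshifted one. (2) `leftSensitivity_tail_budget_core`:
transfer to `F = p_N` by the truncations `F_k = χ_k p_N ∈ C_c` exactly as in `leftSensitivity_budget_of_smooth_core`
(dominated convergence inside the kernels, Fatou in `(z, σ)`, Fatou in `s`); the right-hand sides
`∫ (K_{t₁}F_k)² dμ₀` now CONVERGE to `S_N(t₁)` — linearity inside the kernels, the `L²(μ₀)`-contraction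
`∫ (K_{t₁}(F_k − p_N))² dμ₀ ≤ ∫ (F_k − p_N)² dμ₀ → 0` (`semigroupBudget_sq_act_le`, dominated convergence) and
`semigroupBudget_tendsto_integral_sq`. No definitions; nothing here closes an item.
-/

noncomputable section

namespace Summit.AtomisticToContinuum.FouriersLaw.Theorems.PhononMeanFreePath

open MeasureTheory ProbabilityTheory Set Filter Topology
open scoped NNReal ENNReal
open Literature.MathematicalPhysics.KineticTheory.HeatConduction
open Literature.MathematicalPhysics.KineticTheory Literature.Probability.Process OscillatorChain
open Summit.AtomisticToContinuum.FouriersLaw.Theorems.IncoherentBounded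
open Summit.AtomisticToContinuum.FouriersLaw.Theorems.SubdiffusiveBondHeat
open Summit.AtomisticToContinuum.FouriersLaw.Theorems.IncoherentChannel.Negative.KernelMoments
  (integrable_momentum_transitionKernel)
open Summit.AtomisticToContinuum.FouriersLaw.Cruxes.ConductanceLowerBound.FarContactFisherSquare
  (ofReal_integral_le_lintegral_ofReal)

section Core

variable {ω₂ lam β γ : ℝ} (hω : 0 < ω₂) (hl : 0 ≤ lam) (hβ : 0 < β) (hγ : 0 < γ) {T : ℝ} (hT : 0 < T)
include hω hl hβ hγ hT

/-- **The smooth left-sensitivity budget on a shifted window.** For the pinned anharmonic chain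
`P = pinnedChain ω₂ lam β γ` on `N + 1` sites (`ω₂, β, γ > 0`, `lam ≥ 0`) with both baths at `T > 0`,
`μ₀ = P.gibbsMeasure (N+1) T`, `K_s` the constructed kernels, `ν = 𝒩(0, T)`, a test observable `F ∈ C_c(Ω)` with
forecasts `u_s = K_s F`, the resampled state `z̃ = (q, p[0 ↦ σ])`, a start time `t₁ ≥ 0` and a horizon `t > 0`:

  `∫_{0<s≤t} ∫ (u_{t₁+s}(z) − u_{t₁+s}(z̃))² d(μ₀ ⊗ ν)(z, σ) ds ≤ (π²/(8γ)) ∫ u_{t₁}² dμ₀`.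

Proof: for `s > 0`, `u_{t₁+s} ∈ C²` (`contDiff_forecast` at time `t₁ + s > 0`) and
`lintegral_resample_sq_le_bathWeight` bounds the inner integral by `(π²/(8γ)) ∫ 2Γ(u_{t₁+s}) dμ₀`; integrate over
`(0, t]` and use the shifted dissipation inequality `dissipation_lintegral_le_shifted` with its `‖u_{t₁+t}‖²` term
dropped. (adapted from `leftSensitivity_budget_smooth`, file `…LeftSensitivitySmooth`) [folklore] -/
theorem leftSensitivity_tail_budget_smooth (N : ℕ) {F : PhaseSpace (N + 1) → ℝ} (hFc : Continuous F)
    (hFs : HasCompactSupport F) {t₁ t : ℝ} (ht₁ : 0 ≤ t₁) (ht : 0 < t) :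
    ∫⁻ s in Ioc (0 : ℝ) t, (∫⁻ x : PhaseSpace (N + 1) × ℝ, ENNReal.ofReal
        (((∫ y, F y ∂((pinnedChain ω₂ lam β γ).transitionKernel (N + 1) T T (t₁ + s).toNNReal x.1)) -
          (∫ y, F y ∂((pinnedChain ω₂ lam β γ).transitionKernel (N + 1) T T (t₁ + s).toNNReal
            ((x.1.1, Function.update x.1.2 0 x.2) : PhaseSpace (N + 1))))) ^ 2)
        ∂(((pinnedChain ω₂ lam β γ).gibbsMeasure (N + 1) T).prod (gaussianReal 0 T.toNNReal))) ≤
      ENNReal.ofReal (Real.pi ^ 2 / (8 * γ) * ∫ x, (∫ y, F y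
        ∂((pinnedChain ω₂ lam β γ).transitionKernel (N + 1) T T t₁.toNNReal x)) ^ 2
        ∂((pinnedChain ω₂ lam β γ).gibbsMeasure (N + 1) T)) := by
  -- adapted from `leftSensitivity_budget_smooth` (file `…IncoherentChannelLeftSensitivitySmooth`)
  have hNp : 0 < N + 1 := Nat.succ_pos N
  -- the shifted dissipation inequality, its `‖K_{t₁+t} F‖²` term dropped
  have hD : ∫⁻ s in Ioc (0 : ℝ) t, ∫⁻ x, ENNReal.ofReal (2 * (γ * ∑ i : Fin (N + 1),
      ((if i.val = 0 then T else 0) + (if i.val = N + 1 - 1 then T else 0)) *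
        partialP i (fun z => ∫ y, F y
          ∂((pinnedChain ω₂ lam β γ).transitionKernel (N + 1) T T (t₁ + s).toNNReal z)) x ^ 2))
        ∂((pinnedChain ω₂ lam β γ).gibbsMeasure (N + 1) T) ≤
      ENNReal.ofReal (∫ x, (∫ y, F y ∂((pinnedChain ω₂ lam β γ).transitionKernel (N + 1) T T t₁.toNNReal x)) ^ 2
        ∂((pinnedChain ω₂ lam β γ).gibbsMeasure (N + 1) T)) :=
    le_add_self.trans
      (dissipation_lintegral_le_shifted ω₂ lam β γ hω hl hβ hγ (N + 1) hNp T hT F hFc hFs t₁ t ht₁ ht)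
  -- the step at a fixed time `s > 0`: fibre Poincaré + the near-bath term of the carré du champ at time `t₁ + s`
  have hstep : ∀ s ∈ Ioc (0 : ℝ) t,
      ∫⁻ x : PhaseSpace (N + 1) × ℝ, ENNReal.ofReal
        (((∫ y, F y ∂((pinnedChain ω₂ lam β γ).transitionKernel (N + 1) T T (t₁ + s).toNNReal x.1)) -
          (∫ y, F y ∂((pinnedChain ω₂ lam β γ).transitionKernel (N + 1) T T (t₁ + s).toNNReal
            ((x.1.1, Function.update x.1.2 0 x.2) : PhaseSpace (N + 1))))) ^ 2)
        ∂(((pinnedChain ω₂ lam β γ).gibbsMeasure (N + 1) T).prod (gaussianReal 0 T.toNNReal)) ≤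
      ENNReal.ofReal (Real.pi ^ 2 / (8 * γ)) * ∫⁻ x, ENNReal.ofReal (2 * (γ * ∑ i : Fin (N + 1),
        ((if i.val = 0 then T else 0) + (if i.val = N + 1 - 1 then T else 0)) *
          partialP i (fun z => ∫ y, F y
            ∂((pinnedChain ω₂ lam β γ).transitionKernel (N + 1) T T (t₁ + s).toNNReal z)) x ^ 2))
        ∂((pinnedChain ω₂ lam β γ).gibbsMeasure (N + 1) T) := fun s hs =>
    lintegral_resample_sq_le_bathWeight hω hl hβ.le hγ hT N
      ((contDiff_forecast hω hl hγ hNp hβ.le hT hT.le hFc hFs (by linarith [hs.1] : 0 < t₁ + s)).of_le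
        (by norm_num))
  -- integrate over `s ∈ (0, t]`
  calc _ ≤ ∫⁻ s in Ioc (0 : ℝ) t, ENNReal.ofReal (Real.pi ^ 2 / (8 * γ)) * ∫⁻ x, ENNReal.ofReal (2 * (γ *
          ∑ i : Fin (N + 1), ((if i.val = 0 then T else 0) + (if i.val = N + 1 - 1 then T else 0)) *
            partialP i (fun z => ∫ y, F y
              ∂((pinnedChain ω₂ lam β γ).transitionKernel (N + 1) T T (t₁ + s).toNNReal z)) x ^ 2))
          ∂((pinnedChain ω₂ lam β γ).gibbsMeasure (N + 1) T) :=
        setLIntegral_mono' measurableSet_Ioc hstep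
    _ = ENNReal.ofReal (Real.pi ^ 2 / (8 * γ)) * ∫⁻ s in Ioc (0 : ℝ) t, ∫⁻ x, ENNReal.ofReal (2 * (γ *
          ∑ i : Fin (N + 1), ((if i.val = 0 then T else 0) + (if i.val = N + 1 - 1 then T else 0)) *
            partialP i (fun z => ∫ y, F y
              ∂((pinnedChain ω₂ lam β γ).transitionKernel (N + 1) T T (t₁ + s).toNNReal z)) x ^ 2))
          ∂((pinnedChain ω₂ lam β γ).gibbsMeasure (N + 1) T) :=
        lintegral_const_mul' _ _ ENNReal.ofReal_ne_top
    _ ≤ ENNReal.ofReal (Real.pi ^ 2 / (8 * γ)) * ENNReal.ofReal (∫ x, (∫ y, F y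
          ∂((pinnedChain ω₂ lam β γ).transitionKernel (N + 1) T T t₁.toNNReal x)) ^ 2
          ∂((pinnedChain ω₂ lam β γ).gibbsMeasure (N + 1) T)) :=
        mul_le_mul_right hD _
    _ = _ := (ENNReal.ofReal_mul (by positivity)).symm

/-- **The left-sensitivity budget of the bath momentum from any start time** (core, curried form). For every
`N`, every start time `t₁ ≥ 0` and every horizon `t > 0`, with `v_s = fcast … N s = K_s p_N` and
`S_N = fnorm … N`,
`∫_{0<s≤t} ofReal(∫ (v_{t₁+s}(z) − v_{t₁+s}(z̃))² d(μ₀ ⊗ ν)) ds ≤ ofReal((π²/(8γ)) S_N(t₁))`: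
truncate `p_N` to `F_k = χ_k p_N ∈ C_c`, apply `leftSensitivity_tail_budget_smooth` to each `F_k`, pass to the
limit inside the forecasts by dominated convergence, then Fatou in `x = (z, σ)` and Fatou in `s` on the left; on the
right `∫ (K_{t₁}F_k)² dμ₀ → S_N(t₁)` by linearity inside the kernels, the `L²(μ₀)`-contraction
`semigroupBudget_sq_act_le` applied to `F_k − p_N` (`∫ (F_k − p_N)² dμ₀ → 0` by dominated convergence) and
`semigroupBudget_tendsto_integral_sq`.
(adapted from `leftSensitivity_budget_of_smooth_core`, file `…IncoherentChannelLeftSensitivity`) [folklore] -/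
theorem leftSensitivity_tail_budget_core (N : ℕ) {t₁ t : ℝ} (ht₁ : 0 ≤ t₁) (ht : 0 < t) :
    ∫⁻ s in Ioc (0 : ℝ) t, ENNReal.ofReal (∫ x : PhaseSpace (N + 1) × ℝ,
      (fcast ω₂ lam β γ T N (t₁ + s) x.1 -
        fcast ω₂ lam β γ T N (t₁ + s) ((x.1.1, Function.update x.1.2 0 x.2) : PhaseSpace (N + 1))) ^ 2
        ∂(((pinnedChain ω₂ lam β γ).gibbsMeasure (N + 1) T).prod (gaussianReal 0 T.toNNReal))) ≤
      ENNReal.ofReal (Real.pi ^ 2 / (8 * γ) * fnorm ω₂ lam β γ T N t₁) := by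
  -- adapted from `leftSensitivity_budget_of_smooth_core` (file `…IncoherentChannelLeftSensitivity`)
  set P := pinnedChain ω₂ lam β γ
  set μ := P.gibbsMeasure (N + 1) T
  set ν : Measure ℝ := gaussianReal 0 T.toNNReal
  haveI : IsProbabilityMeasure μ := pinnedChain_isProbabilityMeasure_gibbsMeasure hω hl hβ.le γ (N + 1) hT
  haveI : ∀ t, IsMarkovKernel (P.transitionKernel (N + 1) T T t) := fun t =>
    pinnedChain_isMarkovKernel_transitionKernel hω hl hβ.le hγ.le (N + 1) T T t
  have hNp : 0 < N + 1 := Nat.succ_pos N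
  -- the truncations `F_k = χ_k · p_N`
  set pL : PhaseSpace (N + 1) → ℝ := fun y => y.2 (Fin.last N)
  have hpLc : Continuous pL := by fun_prop
  set χ : ℕ → ContDiffBump (0 : PhaseSpace (N + 1)) := fun k =>
    ⟨(k : ℝ) + 1, (k : ℝ) + 2, by positivity, by linarith⟩
  set Fk : ℕ → PhaseSpace (N + 1) → ℝ := fun k y => (χ k) y * pL y with hFk
  have hFkc : ∀ k, Continuous (Fk k) := fun k => (χ k).continuous.mul hpLc
  have hFks : ∀ k, HasCompactSupport (Fk k) := fun k => (χ k).hasCompactSupport.mul_right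
  have hFk_le : ∀ k y, |Fk k y| ≤ |pL y| := fun k y => by
    rw [hFk]; dsimp only; rw [abs_mul, abs_of_nonneg (χ k).nonneg]
    exact mul_le_of_le_one_left (abs_nonneg _) (χ k).le_one
  have hFk_sub_le : ∀ k y, |Fk k y - pL y| ≤ |pL y| := fun k y => by
    have e : Fk k y - pL y = ((χ k) y - 1) * pL y := by rw [hFk]; ring
    rw [e, abs_mul]
    refine mul_le_of_le_one_left (abs_nonneg _) (abs_le.2 ⟨?_, ?_⟩)
    · linarith [(χ k).nonneg (x := y)]
    · linarith [(χ k).le_one (x := y)]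
  have hFk_lim : ∀ y, Tendsto (fun k => Fk k y) atTop (𝓝 (pL y)) := by
    intro y
    refine tendsto_const_nhds.congr' ?_
    obtain ⟨k₀, hk₀⟩ := exists_nat_ge ‖y‖
    filter_upwards [eventually_ge_atTop k₀] with k hk
    rw [hFk]; dsimp only
    rw [(χ k).one_of_mem_closedBall, one_mul]
    rw [Metric.mem_closedBall, dist_zero_right]
    calc ‖y‖ ≤ k₀ := hk₀
      _ ≤ k := by exact_mod_cast hk
      _ ≤ (k : ℝ) + 1 := by linarith
  -- square-integrability under `μ₀`: `F_k², (F_k - p_N)² ≤ p_N² ∈ L¹(μ₀)`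
  have hϑ0 : (0 : ℝ) < 1 / (4 * T) := by positivity
  have hϑ1 : 1 / (4 * T) < 1 / T := by
    rw [div_lt_div_iff₀ (by positivity) hT]; nlinarith
  have hexpμ := pinnedChain_integrable_exp_mul_hamiltonian_gibbsMeasure hω hl hβ.le γ (N + 1) hT hϑ1
  have hpL2 : Integrable (fun y => pL y ^ 2) μ :=
    integrable_of_abs_le_exp hexpμ (by fun_prop) (fun y => by
      rw [abs_of_nonneg (sq_nonneg _)]
      exact sq_momentum_le_exp (γ := γ) hω hl hβ.le hϑ0 y (Fin.last N))
  have hFk2 : ∀ k, Integrable (fun y => Fk k y ^ 2) μ := fun k =>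
    hpL2.mono' ((hFkc k).pow 2).aestronglyMeasurable (ae_of_all _ fun y => by
      rw [Real.norm_eq_abs, abs_of_nonneg (sq_nonneg _)]
      exact sq_le_sq.2 (hFk_le k y))
  have hd2 : ∀ k, Integrable (fun y => (Fk k y - pL y) ^ 2) μ := fun k =>
    hpL2.mono' (((hFkc k).sub hpLc).pow 2).aestronglyMeasurable (ae_of_all _ fun y => by
      rw [Real.norm_eq_abs, abs_of_nonneg (sq_nonneg _)]
      exact sq_le_sq.2 (hFk_sub_le k y))
  -- `∫ (F_k - p_N)² dμ₀ → 0` (dominated convergence)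
  have hd0 : Tendsto (fun k => ∫ y, (Fk k y - pL y) ^ 2 ∂μ) atTop (𝓝 0) := by
    have h := tendsto_integral_of_dominated_convergence (μ := μ) (F := fun k y => (Fk k y - pL y) ^ 2)
      (f := fun _ => (0 : ℝ)) (fun y => pL y ^ 2)
      (fun k => (((hFkc k).sub hpLc).pow 2).aestronglyMeasurable) hpL2
      (fun k => ae_of_all _ fun y => by
        rw [Real.norm_eq_abs, abs_of_nonneg (sq_nonneg _)]
        exact sq_le_sq.2 (hFk_sub_le k y))
      (ae_of_all _ fun y => by
        have := ((hFk_lim y).sub_const (pL y)).pow 2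
        simpa using this)
    simpa using h
  -- the approximating forecasts `U_k s = K_s F_k` and their pointwise limit `v_s = K_s p_N`
  -- (as ONE function of `(s, z)`, for the joint measurability below)
  set Uk : ℕ → ℝ × PhaseSpace (N + 1) → ℝ := fun k q =>
    ∫ y, Fk k y ∂(P.transitionKernel (N + 1) T T q.1.toNNReal q.2)
  -- dominated convergence inside the kernels
  have hin : ∀ (s : ℝ) (z : PhaseSpace (N + 1)),
      Tendsto (fun k => Uk k (s, z)) atTop (𝓝 (fcast ω₂ lam β γ T N s z)) := by
    intro s z
    show Tendsto (fun k => ∫ y, Fk k y ∂(P.transitionKernel (N + 1) T T s.toNNReal z)) atTop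
      (𝓝 (∫ y, pL y ∂(P.transitionKernel (N + 1) T T s.toNNReal z)))
    have hexpK := pinnedChain_integrable_exp_mul_hamiltonian_transitionKernel hω hl hT hβ.le hγ.le hNp hϑ0 hϑ1
      s.toNNReal z
    have hbd : Integrable (fun y => |pL y|) (P.transitionKernel (N + 1) T T s.toNNReal z) :=
      integrable_of_abs_le_exp hexpK (by fun_prop) (fun y => by
        rw [abs_abs]; exact abs_momentum_le_exp hω hl hβ.le hϑ0 y (Fin.last N))
    refine tendsto_integral_of_dominated_convergence (fun y => |pL y|)
      (fun k => (hFkc k).aestronglyMeasurable) hbd (fun k => ae_of_all _ fun y => ?_)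
      (ae_of_all _ fun y => hFk_lim y)
    rw [Real.norm_eq_abs]; exact hFk_le k y
  -- the resampling map `x = (z, σ) ↦ z̃`
  set R : PhaseSpace (N + 1) × ℝ → PhaseSpace (N + 1) := fun x =>
    ((x.1.1, Function.update x.1.2 0 x.2) : PhaseSpace (N + 1))
  have hRm : Measurable R := lightCone_measurable_resample 0
  -- joint measurability of `(s, z) ↦ U_k s z` (joint measurability of the transition kernels)
  let κ₂ : Kernel (ℝ≥0 × PhaseSpace (N + 1)) (PhaseSpace (N + 1)) :=
    { toFun := fun p => P.transitionKernel (N + 1) T T p.1 p.2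
      measurable' := pinnedChain_measurable_transitionKernel hω hl hβ.le hγ.le (N + 1) T T }
  have hUk_jm : ∀ k, Measurable (Uk k) := by
    intro k
    have hG : StronglyMeasurable fun p : ℝ≥0 × PhaseSpace (N + 1) => ∫ y, Fk k y ∂(κ₂ p) :=
      (hFkc k).stronglyMeasurable.integral_kernel (κ := κ₂)
    have hG2 : StronglyMeasurable fun q : ℝ × PhaseSpace (N + 1) => ∫ y, Fk k y ∂(κ₂ (q.1.toNNReal, q.2)) :=
      hG.comp_measurable ((measurable_real_toNNReal.comp measurable_fst).prodMk measurable_snd)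
    exact hG2.measurable
  -- the approximating integrands at the SHIFTED times `t₁ + s`, jointly measurable in `(s, x)`
  have hq1 : Measurable fun q : ℝ × (PhaseSpace (N + 1) × ℝ) => ((t₁ + q.1, q.2.1) : ℝ × PhaseSpace (N + 1)) :=
    (measurable_fst.const_add t₁).prodMk (measurable_fst.comp measurable_snd)
  have hq2 : Measurable fun q : ℝ × (PhaseSpace (N + 1) × ℝ) => ((t₁ + q.1, R q.2) : ℝ × PhaseSpace (N + 1)) :=
    (measurable_fst.const_add t₁).prodMk (hRm.comp measurable_snd)
  set Gk : ℕ → ℝ × (PhaseSpace (N + 1) × ℝ) → ℝ≥0∞ := fun k q =>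
    ENNReal.ofReal ((Uk k (t₁ + q.1, q.2.1) - Uk k (t₁ + q.1, R q.2)) ^ 2)
  have hGk_meas : ∀ k, Measurable (Gk k) := fun k =>
    ((((hUk_jm k).comp hq1).sub ((hUk_jm k).comp hq2)).pow_const 2).ennreal_ofReal
  -- (i) for each `s`: Bochner ≤ lower integral, then Fatou in `x`
  have hFx : ∀ s : ℝ, ENNReal.ofReal (∫ x, (fcast ω₂ lam β γ T N (t₁ + s) x.1 -
      fcast ω₂ lam β γ T N (t₁ + s) (R x)) ^ 2 ∂(μ.prod ν)) ≤
      liminf (fun k => ∫⁻ x, Gk k (s, x) ∂(μ.prod ν)) atTop := by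
    intro s
    have hl1 : ∀ x, liminf (fun k => Gk k (s, x)) atTop =
        ENNReal.ofReal ((fcast ω₂ lam β γ T N (t₁ + s) x.1 - fcast ω₂ lam β γ T N (t₁ + s) (R x)) ^ 2) :=
      fun x => (ENNReal.tendsto_ofReal (((hin (t₁ + s) x.1).sub (hin (t₁ + s) (R x))).pow 2)).liminf_eq
    calc ENNReal.ofReal (∫ x, (fcast ω₂ lam β γ T N (t₁ + s) x.1 -
          fcast ω₂ lam β γ T N (t₁ + s) (R x)) ^ 2 ∂(μ.prod ν))
        ≤ ∫⁻ x, ENNReal.ofReal ((fcast ω₂ lam β γ T N (t₁ + s) x.1 -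
            fcast ω₂ lam β γ T N (t₁ + s) (R x)) ^ 2) ∂(μ.prod ν) :=
          ofReal_integral_le_lintegral_ofReal (μ.prod ν) fun x => sq_nonneg _
      _ = ∫⁻ x, liminf (fun k => Gk k (s, x)) atTop ∂(μ.prod ν) := lintegral_congr fun x => (hl1 x).symm
      _ ≤ liminf (fun k => ∫⁻ x, Gk k (s, x) ∂(μ.prod ν)) atTop :=
          lintegral_liminf_le fun k => (hGk_meas k).comp measurable_prodMk_left
  -- (ii) measurability in `s` of the approximating terms (Tonelli), for Fatou in `s`
  have hIk_meas : ∀ k, Measurable fun s : ℝ => ∫⁻ x, Gk k (s, x) ∂(μ.prod ν) := fun k =>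
    (hGk_meas k).lintegral_prod_right'
  -- (iii) the smooth shifted budget of each truncation
  have hk_bound : ∀ k, ∫⁻ s in Ioc (0 : ℝ) t, ∫⁻ x, Gk k (s, x) ∂(μ.prod ν) ≤
      ENNReal.ofReal (Real.pi ^ 2 / (8 * γ) * ∫ z, Uk k (t₁, z) ^ 2 ∂μ) := fun k =>
    leftSensitivity_tail_budget_smooth hω hl hβ hγ hT N (hFkc k) (hFks k) ht₁ ht
  -- (iv) the right-hand sides converge: `∫ (K_{t₁}F_k)² dμ₀ → S_N(t₁)`
  have hlin : ∀ k z, Uk k (t₁, z) - fcast ω₂ lam β γ T N t₁ z =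
      ∫ y, (Fk k y - pL y) ∂(P.transitionKernel (N + 1) T T t₁.toNNReal z) := by
    intro k z
    have h1 : Integrable (Fk k) (P.transitionKernel (N + 1) T T t₁.toNNReal z) :=
      (hFkc k).integrable_of_hasCompactSupport (hFks k)
    have h2 : Integrable pL (P.transitionKernel (N + 1) T T t₁.toNNReal z) :=
      integrable_momentum_transitionKernel hω hl hβ.le hγ.le hNp hT _ z _
    rw [integral_sub h1 h2]
    rfl
  have hE : ∀ k, ∫ z, (Uk k (t₁, z) - fcast ω₂ lam β γ T N t₁ z) ^ 2 ∂μ ≤ ∫ y, (Fk k y - pL y) ^ 2 ∂μ := by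
    intro k
    calc ∫ z, (Uk k (t₁, z) - fcast ω₂ lam β γ T N t₁ z) ^ 2 ∂μ
        = ∫ z, (∫ y, (Fk k y - pL y) ∂(P.transitionKernel (N + 1) T T t₁.toNNReal z)) ^ 2 ∂μ :=
          integral_congr_ae (Eventually.of_forall fun z => congrArg (fun w : ℝ => w ^ 2) (hlin k z))
      _ ≤ ∫ y, (Fk k y - pL y) ^ 2 ∂μ :=
          (semigroupBudget_sq_act_le hω hl hβ hγ hT N ((hFkc k).measurable.sub hpLc.measurable) (hd2 k)
            t₁.toNNReal).2.2
  have hE0 : Tendsto (fun k => ∫ z, (Uk k (t₁, z) - fcast ω₂ lam β γ T N t₁ z) ^ 2 ∂μ) atTop (𝓝 0) :=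
    squeeze_zero (fun k => integral_nonneg fun z => sq_nonneg _) hE hd0
  have hfm := lightCone_fcast_moments ω₂ lam β γ hω hl hβ.le hγ.le T hT N t₁
  have hUk2 : ∀ k, Integrable (fun z => Uk k (t₁, z) ^ 2) μ := fun k =>
    (semigroupBudget_sq_act_le hω hl hβ hγ hT N (hFkc k).measurable (hFk2 k) t₁.toNNReal).2.1
  have hUkm : ∀ k, Measurable fun z => Uk k (t₁, z) := fun k => (hUk_jm k).comp measurable_prodMk_left
  have hRHS : Tendsto (fun k => ∫ z, Uk k (t₁, z) ^ 2 ∂μ) atTop (𝓝 (fnorm ω₂ lam β γ T N t₁)) :=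
    semigroupBudget_tendsto_integral_sq (fun k => (hUkm k).aestronglyMeasurable) hfm.1.aestronglyMeasurable
      hUk2 hfm.2.1 hE0
  -- (v) Fatou in `s` and the conclusion
  calc ∫⁻ s in Ioc (0 : ℝ) t, ENNReal.ofReal (∫ x, (fcast ω₂ lam β γ T N (t₁ + s) x.1 -
        fcast ω₂ lam β γ T N (t₁ + s) (R x)) ^ 2 ∂(μ.prod ν))
      ≤ ∫⁻ s in Ioc (0 : ℝ) t, liminf (fun k => ∫⁻ x, Gk k (s, x) ∂(μ.prod ν)) atTop :=
        lintegral_mono fun s => hFx s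
    _ ≤ liminf (fun k => ∫⁻ s in Ioc (0 : ℝ) t, ∫⁻ x, Gk k (s, x) ∂(μ.prod ν)) atTop :=
        lintegral_liminf_le hIk_meas
    _ ≤ liminf (fun k => ENNReal.ofReal (Real.pi ^ 2 / (8 * γ) * ∫ z, Uk k (t₁, z) ^ 2 ∂μ)) atTop :=
        liminf_le_liminf (Eventually.of_forall hk_bound)
    _ = ENNReal.ofReal (Real.pi ^ 2 / (8 * γ) * fnorm ω₂ lam β γ T N t₁) :=
        (ENNReal.tendsto_ofReal (hRHS.const_mul (Real.pi ^ 2 / (8 * γ)))).liminf_eq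

end Core

/-- **THE LEFT-SENSITIVITY BUDGET OF THE FORECAST FROM ANY START TIME, slaved to the forecast norm** (registered
stub `leftSensitivity_tail_budget` of line `two-horizons-forecast-loss`). For the pinned anharmonic chain
(`ω₂, β, γ > 0`, `lam ≥ 0`) with both baths at `T > 0`, `μ₀ = gibbsMeasure (N+1) T`, `K_s` the transition kernels,
`ν = 𝒩(0, T)`, `z̃ = (z.1, update z.2 0 σ)` the microstate with the near-bath momentum resampled, `v_s = K_s p_N` the
mean forecast of the far bath momentum and `S_N(s) = ‖v_s‖²_{L²(μ₀)}`: for EVERY `N`, every start time `t₁ ≥ 0` and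
every horizon `t > 0`,

  `∫_{0<s≤t} ∫ (v_{t₁+s}(z) − v_{t₁+s}(z̃))² d(μ₀ ⊗ ν) ds ≤ (π²/(8γ)) · S_N(t₁)`

(lower Lebesgue integral in `s`; `S_N(0) = T` recovers `leftSensitivity_budget_holds`). Proof:
`leftSensitivity_tail_budget_core` — the smooth shifted budget `leftSensitivity_tail_budget_smooth` (resampling
Poincaré inequality × the near-bath tap of the SHIFTED dissipation inequality) pushed to `p_N` by truncation, with the
right-hand sides converging to `S_N(t₁)` by the `L²(μ₀)`-contraction of `K_{t₁}`. [folklore] -/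
theorem leftSensitivity_tail_budget : ∀ ω₂ lam β γ : ℝ, 0 < ω₂ → 0 ≤ lam → 0 < β → 0 < γ → ∀ T : ℝ, 0 < T → ∀ (N : ℕ) (t₁ t : ℝ), 0 ≤ t₁ → 0 < t → ∫⁻ s in Ioc (0 : ℝ) t, ENNReal.ofReal (∫ x : PhaseSpace (N + 1) × ℝ, (fcast ω₂ lam β γ T N (t₁ + s) x.1 - fcast ω₂ lam β γ T N (t₁ + s) ((x.1.1, Function.update x.1.2 0 x.2) : PhaseSpace (N + 1))) ^ 2 ∂(((pinnedChain ω₂ lam β γ).gibbsMeasure (N + 1) T).prod (ProbabilityTheory.gaussianReal 0 T.toNNReal))) ≤ ENNReal.ofReal (Real.pi ^ 2 / (8 * γ) * fnorm ω₂ lam β γ T N t₁) :=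
  fun _ _ _ _ hω hl hβ hγ _ hT N _ _ ht₁ ht => leftSensitivity_tail_budget_core hω hl hβ hγ hT N ht₁ ht

end Summit.AtomisticToContinuum.FouriersLaw.Theorems.PhononMeanFreePath

end
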